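import Summits.RiemannHypothesis.RiemannHypothesis.Theses.NymanBeurling
import Summits.RiemannHypothesis.RiemannHypothesis.Theorems.NymanBeurlingNbThesis

/-!
# Witness (F3 / BC5-shape) for the rung `NbLineBelowOne` of crux `NbThesis`
(stmt-RiemannHypothesis-0392): the rung family specialised to its PROVED floor, and to its top

Rung family (same text as `Lines/NbLineBelowOne.lean`): `NbLine σ` = the Nyman–Beurling–Báez-Duarte
weighted `L²` approximation of `1` by `ζ(s)·A(s)` (`A` a Dirichlet polynomial) on the line `Re s = σ`,
weight `|s-1|²/|s|⁴`.  The filed rung is `NbLineBelowOne : ∃ σ < 1, NbLine σ`.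

* TOP `σ = 1/2`: `NbLine (1/2) ↔ NbThesis ↔ Summit.RiemannHypothesis` (`nbLine_half_iff`,
  `nbLine_half_iff_riemannHypothesis`; the second `↔` is the landed `Theorems.nbThesis_iff`).
* FLOOR, PROVED IN THIS FILE (no sorry): `nbLine_of_one_lt : 1 < σ → NbLine σ` — on every line
  strictly right of `Re s = 1` the approximation holds, with the natural approximant
  `A_N(s) = Σ_{n ≤ N} μ(n) n^{-s}`: `1 - ζ A_N = ζ · Σ_{n > N} μ(n) n^{-s}` (Mathlib
  `LSeries_one_mul_Lseries_moebius`), `|ζ(σ+it)| ≤ ζ(σ)`, the tail is bounded uniformly in `t` by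
  the tail of `Σ n^{-σ}` (`tendsto_sum_nat_add`), and the weight is `≤ (1+t²)⁻¹` whose integral is `π`
  (`integral_univ_inv_one_add_sq`).
* FLOOR IN PRINT (not yet a tree theorem; PNT-depth): `σ = 1` — Théorème NBBF at `p = 1`
  (Bercovici–Foias 1984, Thm 2.5, as stated in Balazard–Saias 1998 p. 311) read through
  Mellin–Plancherel; recorded as the named statement `FloorAtOne` below, used nowhere.

witness_regime: abscissae `σ > 1` (proved here) and `σ = 1` (print).  Is S known there?  The
zero-content of `NbLine σ` is "`ζ ≠ 0` on `Re s > σ`" (Beurling's easy half), which for `σ ≥ 1` is the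
Euler product / Hadamard–de la Vallée Poussin regime: KNOWN.  S itself (`σ = 1/2`) is open in every
regime.  The first rung whose zero-content is OPEN is exactly the filed one, `σ < 1` (equivalent in
print to a zero-free vertical strip, route Strip's crux #2, stmt-RiemannHypothesis-10660):
disposition FRONTIER.  No `sorry` in this file.
-/

set_option linter.dupNamespace false

noncomputable section

namespace Summit.RiemannHypothesis.RiemannHypothesis.Cruxes.NbThesis.NbLineBelowOne.Special

open MeasureTheory Filter Topology Complex LSeries
open scoped Real ENNReal
open Summit.RiemannHypothesis.RiemannHypothesis.Theses.NymanBeurling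

/-- Rung family (copy of the line file's `NbLine`): the Báez-Duarte approximation on `Re s = σ`
with the pole-killing Cauchy weight. [cite: BaezDuarte2003, Thm 1.1 (σ = 1/2); arXiv:2606.16097, Prop 3.1 and Thm 3.1 (general abscissa)] -/
def NbLine (σ : ℝ) : Prop :=
  ∀ ε : ℝ, 0 < ε → ∃ (N : ℕ) (a : Fin N → ℂ),
    ∫⁻ t : ℝ, ENNReal.ofReal (‖1 - riemannZeta ((σ : ℂ) + t * Complex.I) *
        ∑ n : Fin N, a n * ((n : ℂ) + 1) ^ (-((σ : ℂ) + t * Complex.I))‖ ^ 2 *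
        (((σ - 1) ^ 2 + t ^ 2) / (σ ^ 2 + t ^ 2) ^ 2)) < ENNReal.ofReal ε

/-- The filed rung (copy of the line file's `NbLineBelowOne`). [cite: BalazardSaias1998, Théorème NBBF p.311] -/
def NbLineBelowOne : Prop :=
  ∃ σ : ℝ, σ < 1 ∧ NbLine σ

/-- The floor in print, `σ = 1` (Bercovici–Foias 1984 Thm 2.5 = NBBF at `p = 1`, via
Mellin–Plancherel).  A NAMED STATEMENT only — not proved in the tree (PNT-depth), used nowhere.
[cite: BalazardSaias1998, p.311 remark (a),(d) (Bercovici–Foias 1984, Thm 2.5)] -/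
def FloorAtOne : Prop := NbLine 1

/-! ## Top: the family contains the crux and the summit -/

/-- `NbLine (1/2) ↔ NbThesis` (the weights agree pointwise on the critical line). [folklore] -/
theorem nbLine_half_iff : NbLine (1 / 2) ↔ NbThesis := by
  have e : ((1 / 2 : ℝ) : ℂ) = 1 / 2 := by push_cast; ring
  have key : ∀ t : ℝ,
      (((1 / 2 : ℝ) - 1) ^ 2 + t ^ 2) / ((1 / 2 : ℝ) ^ 2 + t ^ 2) ^ 2 = 1 / (1 / 4 + t ^ 2) := by
    intro t
    have h : (0 : ℝ) < 1 / 4 + t ^ 2 := by positivity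
    field_simp
    ring
  simp only [NbLine, NbThesis, e, key, mul_one_div]

/-- `NbLine (1/2) ↔ Summit.RiemannHypothesis`. [folklore] -/
theorem nbLine_half_iff_riemannHypothesis : NbLine (1 / 2) ↔ Summit.RiemannHypothesis :=
  nbLine_half_iff.trans Theorems.nbThesis_iff

/-- The rung is the `σ < 1` member of the family, verbatim. [folklore] -/
example : NbLineBelowOne ↔ ∃ σ : ℝ, σ < 1 ∧ NbLine σ := Iff.rfl

/-! ## The proved floor: every line strictly right of `Re s = 1` -/

/-- The Möbius function as a complex sequence (local notation). -/
local notation "μ'" => (fun n : ℕ ↦ ((ArithmeticFunction.moebius n : ℤ) : ℂ))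

/-- The pole-killing weight is dominated by the Cauchy weight: for `σ ≥ 1`,
`((σ-1)²+t²)/(σ²+t²)² ≤ (1+t²)⁻¹`. [folklore] -/
theorem weight_le_inv_one_add_sq {σ : ℝ} (hσ : 1 ≤ σ) (t : ℝ) :
    ((σ - 1) ^ 2 + t ^ 2) / (σ ^ 2 + t ^ 2) ^ 2 ≤ (1 + t ^ 2)⁻¹ := by
  have h1 : (0 : ℝ) < σ ^ 2 + t ^ 2 := by positivity
  have h2 : (0 : ℝ) < 1 + t ^ 2 := by positivity
  rw [inv_eq_one_div, div_le_div_iff₀ (pow_pos h1 2) h2]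
  have h3 : (σ - 1) ^ 2 ≤ σ ^ 4 := by nlinarith [sq_nonneg (σ - 1), sq_nonneg σ]
  have h4 : (0 : ℝ) ≤ σ ^ 2 + 2 * σ - 2 := by nlinarith
  nlinarith [mul_nonneg (sq_nonneg t) h4, h3, sq_nonneg t]

/-- Majorant of `|ζ(σ+it)|`, uniform in `t`: `Z(σ) = Σ_{n≥1} n^{-σ}` (as the sum of the norms of
the terms of `L(1, σ)`). [folklore] -/
def zMaj (σ : ℝ) : ℝ := ∑' n : ℕ, ‖term (1 : ℕ → ℂ) (σ : ℂ) n‖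

/-- Majorant of the Möbius tail, uniform in `t`: `T_σ(k) = Σ_i |μ(i+k)| (i+k)^{-σ}`. [folklore] -/
def tMaj (σ : ℝ) (k : ℕ) : ℝ := ∑' i : ℕ, ‖term μ' (σ : ℂ) (i + k)‖

/-- The tail majorant tends to `0` (no summability hypothesis needed). [folklore] -/
theorem tendsto_tMaj (σ : ℝ) : Tendsto (tMaj σ) atTop (𝓝 0) :=
  tendsto_sum_nat_add fun i ↦ ‖term μ' (σ : ℂ) i‖

/-- The norm of an `L`-series term depends only on `Re s`. [folklore] -/
theorem norm_term_eq_norm_term_re (f : ℕ → ℂ) (s : ℂ) (n : ℕ) :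
    ‖term f s n‖ = ‖term f (s.re : ℂ) n‖ := by
  simp only [norm_term_eq, ofReal_re]

/-- The Dirichlet polynomial `Σ_{n<N} μ(n+1)(n+1)^{-s}` is the head `Σ_{m ≤ N}` of the Möbius
`L`-series. [folklore] -/
theorem moebiusSum_eq (s : ℂ) (N : ℕ) :
    ∑ n : Fin N, ((ArithmeticFunction.moebius ((n : ℕ) + 1) : ℤ) : ℂ) * (((n : ℕ) : ℂ) + 1) ^ (-s) =
      ∑ m ∈ Finset.range (N + 1), term μ' s m := by
  rw [Finset.sum_range_succ', term_zero, add_zero, Finset.sum_range]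
  refine Finset.sum_congr rfl fun n _ ↦ ?_
  rw [term_of_ne_zero (Nat.add_one_ne_zero _), cpow_neg, div_eq_mul_inv, Nat.cast_add,
    Nat.cast_one]

/-- **The tail identity on `Re s > 1`:** `1 - ζ(s)·Σ_{n ≤ N} μ(n) n^{-s} = ζ(s)·Σ_{n > N} μ(n) n^{-s}`
(from `ζ(s)·L(μ,s) = 1`, Mathlib `LSeries_one_mul_Lseries_moebius`). [folklore] -/
theorem one_sub_zeta_mul_moebiusSum {s : ℂ} (hs1 : 1 < s.re) (N : ℕ) :
    1 - riemannZeta s *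
        ∑ n : Fin N, ((ArithmeticFunction.moebius ((n : ℕ) + 1) : ℤ) : ℂ) * (((n : ℕ) : ℂ) + 1) ^ (-s) =
      riemannZeta s * ∑' i : ℕ, term μ' s (i + (N + 1)) := by
  have hz : riemannZeta s * LSeries μ' s = 1 := by
    have h := LSeries_one_mul_Lseries_moebius hs1
    rwa [LSeries_one_eq_riemannZeta hs1] at h
  have hμs : Summable (term μ' s) := ArithmeticFunction.LSeriesSummable_moebius_iff.2 hs1
  have htail : ∑' i : ℕ, term μ' s (i + (N + 1)) =
      (∑' i : ℕ, term μ' s i) - ∑ i ∈ Finset.range (N + 1), term μ' s i :=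
    eq_sub_of_add_eq' (hμs.sum_add_tsum_nat_add (N + 1))
  rw [htail, moebiusSum_eq, ← hz, LSeries]
  ring

/-- `|ζ(s)| ≤ Z(Re s)` for `Re s > 1`. [folklore] -/
theorem norm_riemannZeta_le_zMaj {s : ℂ} (hs1 : 1 < s.re) : ‖riemannZeta s‖ ≤ zMaj s.re := by
  have h1s : Summable (term (1 : ℕ → ℂ) s) := LSeriesSummable_one_iff.2 hs1
  rw [← LSeries_one_eq_riemannZeta hs1, LSeries, zMaj]
  exact (norm_tsum_le_tsum_norm h1s.norm).trans
    (le_of_eq (tsum_congr fun n ↦ norm_term_eq_norm_term_re 1 s n))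

/-- The Möbius tail is bounded by `T_{Re s}(k)` for `Re s > 1`. [folklore] -/
theorem norm_moebiusTail_le_tMaj {s : ℂ} (hs1 : 1 < s.re) (k : ℕ) :
    ‖∑' i : ℕ, term μ' s (i + k)‖ ≤ tMaj s.re k := by
  have hμs : Summable (term μ' s) := ArithmeticFunction.LSeriesSummable_moebius_iff.2 hs1
  have hsn : Summable fun i ↦ ‖term μ' s (i + k)‖ :=
    (summable_nat_add_iff (f := fun n ↦ ‖term μ' s n‖) k).2 hμs.norm
  rw [tMaj]
  exact (norm_tsum_le_tsum_norm hsn).trans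
    (le_of_eq (tsum_congr fun i ↦ norm_term_eq_norm_term_re _ s (i + k)))

/-- **Uniform bound on the line `Re s = σ > 1`:** `‖1 - ζ(σ+it) A_N(σ+it)‖ ≤ Z(σ)·T_σ(N+1)` for the
natural approximant `A_N`. [folklore] -/
theorem norm_one_sub_le {σ : ℝ} (hσ : 1 < σ) (N : ℕ) (t : ℝ) :
    ‖1 - riemannZeta ((σ : ℂ) + t * I) *
        ∑ n : Fin N, ((ArithmeticFunction.moebius ((n : ℕ) + 1) : ℤ) : ℂ) *
          (((n : ℕ) : ℂ) + 1) ^ (-((σ : ℂ) + t * I))‖ ≤ zMaj σ * tMaj σ (N + 1) := by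
  have hre : ((σ : ℂ) + t * I).re = σ := by simp
  have hs1 : 1 < ((σ : ℂ) + t * I).re := by rw [hre]; exact hσ
  rw [one_sub_zeta_mul_moebiusSum hs1, norm_mul]
  have hZ := norm_riemannZeta_le_zMaj hs1
  have hT := norm_moebiusTail_le_tMaj hs1 (N + 1)
  rw [hre] at hZ hT
  exact mul_le_mul hZ hT (norm_nonneg _) (tsum_nonneg fun _ ↦ norm_nonneg _)

/-- **THE WITNESS: the rung family at every floor parameter `σ > 1` holds, proved here.**
`NbLine σ` for `1 < σ`, with the natural approximant `A_N(s) = Σ_{n ≤ N} μ(n) n^{-s}`.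
[folklore] -/
theorem nbLine_of_one_lt {σ : ℝ} (hσ : 1 < σ) : NbLine σ := by
  intro ε hε
  -- choose the length of the Dirichlet polynomial
  have hev : ∀ᶠ k : ℕ in atTop, (zMaj σ * tMaj σ k) ^ 2 * π < ε := by
    have h : Tendsto (fun k ↦ (zMaj σ * tMaj σ k) ^ 2 * π) atTop
        (𝓝 ((zMaj σ * 0) ^ 2 * π)) :=
      (((tendsto_tMaj σ).const_mul (zMaj σ)).pow 2).mul_const π
    rw [mul_zero, zero_pow two_ne_zero, zero_mul] at h
    exact h.eventually (gt_mem_nhds hε)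
  obtain ⟨N, hN'⟩ := eventually_atTop.1 hev
  have hN : (zMaj σ * tMaj σ (N + 1)) ^ 2 * π < ε := hN' (N + 1) (Nat.le_succ _)
  refine ⟨N, fun n ↦ ((ArithmeticFunction.moebius ((n : ℕ) + 1) : ℤ) : ℂ), ?_⟩
  -- pointwise bound, uniform in `t`
  have hpt : ∀ t : ℝ,
      ‖1 - riemannZeta ((σ : ℂ) + t * I) *
          ∑ n : Fin N, ((ArithmeticFunction.moebius ((n : ℕ) + 1) : ℤ) : ℂ) *
            (((n : ℕ) : ℂ) + 1) ^ (-((σ : ℂ) + t * I))‖ ^ 2 *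
        (((σ - 1) ^ 2 + t ^ 2) / (σ ^ 2 + t ^ 2) ^ 2) ≤
      (zMaj σ * tMaj σ (N + 1)) ^ 2 * (1 + t ^ 2)⁻¹ := fun t ↦
    mul_le_mul (pow_le_pow_left₀ (norm_nonneg _) (norm_one_sub_le hσ N t) 2)
      (weight_le_inv_one_add_sq hσ.le t) (by positivity) (sq_nonneg _)
  -- integrate
  calc _ ≤ ∫⁻ t : ℝ, ENNReal.ofReal ((zMaj σ * tMaj σ (N + 1)) ^ 2 * (1 + t ^ 2)⁻¹) :=
        lintegral_mono fun t ↦ ENNReal.ofReal_le_ofReal (hpt t)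
    _ = ENNReal.ofReal (∫ t : ℝ, (zMaj σ * tMaj σ (N + 1)) ^ 2 * (1 + t ^ 2)⁻¹) :=
        (ofReal_integral_eq_lintegral_ofReal (integrable_inv_one_add_sq.const_mul _)
          (Eventually.of_forall fun t ↦ by positivity)).symm
    _ = ENNReal.ofReal ((zMaj σ * tMaj σ (N + 1)) ^ 2 * π) := by
        rw [integral_const_mul, integral_univ_inv_one_add_sq]
    _ < ENNReal.ofReal ε := (ENNReal.ofReal_lt_ofReal_iff hε).2 hN

/-- The F3 shape verbatim at the floor parameter `σ = 2`. [folklore] -/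
example : NbLine 2 := nbLine_of_one_lt one_lt_two

/-- Every floor member in the proved regime, in the `∃`-shape of the rung with the inequality
reversed (`1 < σ` instead of `σ < 1`): the ONE parameter moved by the rung is the abscissa.
[folklore] -/
theorem floor_exists : ∃ σ : ℝ, 1 < σ ∧ NbLine σ := ⟨2, one_lt_two, nbLine_of_one_lt one_lt_two⟩

end Summit.RiemannHypothesis.RiemannHypothesis.Cruxes.NbThesis.NbLineBelowOne.Special

end
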